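import Literature.MathematicalPhysics.KineticTheory.HardSphereEuler
import Literature.Analysis.FunctionSpaces.TorusSpaceTimeConvolution
import Summits.AtomisticToContinuum.HydrodynamicLimit.Theorems.JaynesSqueezeHardSphereLDAConvexity
import HarnessLib

/-!
# Second-order mollifier-commutator estimate on `𝕋³` (RoutePatchC11 §2, crux `CollisionalTransferLocality`,
# stmt-AtomisticToContinuum-9518, line `hemisphere-affine-slaving`)

Supporting file (`--supports stmt-AtomisticToContinuum-9518`) proving the registered deterministic
analysis lemma `mollifierCommutator_secondOrder`, the abstract core of RoutePatchC11 §2: the defect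
between a weighted nonlinear functional of a field `U` and of its mollification `b ⋆ U`,
`∫ w [F(b ⋆ U) − F(U)]`, is SECOND ORDER in the distance `e = U − U_c` to a smooth comparison field
`U_c`, except for one linear term that carries the mollification radius `r`:

  `|∫ w (F(b⋆U) − F(U))| ≤ G r ∫|e| + A ∫|b⋆U_c − U_c| + 3 W M ∫ e² + 2 W M ∫ (b⋆U_c − U_c)²`.

Here `𝕋³ = UnitAddTorus (Fin 3)` with its Haar probability measure, `(b ⋆ f)(x) = ∫ b(y) f(x − y) dy`
(written inline), `b ≥ 0` is a continuous even kernel of unit mass vanishing outside the flat ball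
`{euclidDist · 0 < r}`, `U` is bounded measurable, `U_c` continuous (both bounded by `K`), `F` satisfies
the Taylor inequality `|F a − F c − F′(c)(a − c)| ≤ M (a − c)²` on `[−K, K]`, `|w| ≤ W`, and the
composite weight `g = w · F′(U_c)` is bounded by `A` and `G`-Lipschitz in the flat (minimal-image) distance
(`|g(x) − g(y)| ≤ G · euclidDist x y`).

Proof (all elementary measure theory on the compact abelian group `𝕋³`):
* pointwise Taylor expansion at `c = U_c(x)` for `a = (b⋆U)(x)` and `a = U(x)`:
  `w (F(b⋆U) − F(U)) = g · (b⋆U − U) + R₁ − R₂`, `|R₁| ≤ W M (b⋆U − U_c)²`, `|R₂| ≤ W M e²`;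
* linearity `b⋆U − U = (b⋆e − e) + (b⋆U_c − U_c)` and `(b⋆U − U_c)² ≤ 2 (b⋆e)² + 2 (b⋆U_c − U_c)²`;
* Jensen `(b⋆e)² ≤ b⋆(e²)` pointwise (variance identity for the probability kernel `b(y)dy`) and
  `∫ b⋆(e²) = ∫ e²` (Fubini and translation invariance, `MollifierCommutator.integral_integral_mul_comp_sub`);
* the COMMUTATOR step `mollifierCommutator_linear`: by evenness of `b`, mollification is symmetric,
  `∫ g (b⋆e) = ∫ (b⋆g) e` (the tree's `Torus.integral_mul_convolution_comm`), so
  `∫ g (b⋆e − e) = ∫ (b⋆g − g) e` and `|(b⋆g − g)(x)| = |∫ b(y)(g(x − y) − g(x))dy| ≤ G r` since `b(y) = 0`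
  unless `euclidDist y 0 < r`; hence `|∫ g (b⋆e − e)| ≤ G r ∫|e|`.
Reused: Mathlib's `Integrable.convolution_integrand`, `integral_integral_swap`, `integral_sub_right_eq_self`,
`Continuous.integrable_of_hasCompactSupport`; the tree's `Torus.integral_mul_convolution_comm`,
`Torus.convolution_comm_real`, `Torus.exists_forall_norm_le_of_continuous` (`FunctionSpaces/TorusSpaceTimeConvolution`,
`TorusConvolution`) and `HardSphereLDA.integrable_T3_of_abs_le` (`Theorems/JaynesSqueezeHardSphereLDAConvexity`).
No new definitions; axioms `propext`, `Classical.choice`, `Quot.sound`.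
-/

namespace Summit.AtomisticToContinuum.HydrodynamicLimit.Theorems.HemisphereAffineSlaving

open scoped BigOperators Topology Classical ENNReal InnerProductSpace
open Filter Set Function MeasureTheory

noncomputable section

open Literature.MathematicalPhysics.KineticTheory (T3 V3)
open Literature.Analysis.FunctionSpaces
open Literature.Analysis.FluidPDE (Torus.euclidDist Torus.euclidDist_eq Torus.euclidDist_comm)

namespace MollifierCommutator

/-! ## Mollification integrands on `𝕋³ × 𝕋³` and on fibres -/

/-- The mollification integrand `(x, y) ↦ b(y) f(x − y)` is integrable on `𝕋³ × 𝕋³` for integrable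
`b`, `f` (Mathlib's `Integrable.convolution_integrand`). -/
theorem integrable_prod_mul_comp_sub {b f : T3 → ℝ} (hb : Integrable b) (hf : Integrable f) :
    Integrable (fun p : T3 × T3 => b p.2 * f (p.1 - p.2)) ((volume : Measure T3).prod volume) := by
  simpa using hb.convolution_integrand (ContinuousLinearMap.mul ℝ ℝ) hf

/-- The fibre integrand `y ↦ b(y) f(x − y)` is integrable for continuous `b` and bounded measurable `f`. -/
theorem integrable_mul_comp_sub {b f : T3 → ℝ} (hb : Continuous b) (hf : Measurable f) {C : ℝ}
    (hC : ∀ x, |f x| ≤ C) (x : T3) : Integrable (fun y => b y * f (x - y)) := by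
  obtain ⟨B, hB⟩ := Torus.exists_forall_norm_le_of_continuous hb
  refine Integrable.of_bound
    ((hb.measurable.mul (hf.comp (measurable_const.sub measurable_id))).aestronglyMeasurable)
    (B * C) (Eventually.of_forall fun y => ?_)
  rw [norm_mul]
  exact mul_le_mul (hB y) ((Real.norm_eq_abs _).trans_le (hC _)) (norm_nonneg _)
    ((norm_nonneg _).trans (hB y))

/-- The mollification `x ↦ ∫ b(y) f(x − y) dy` of a measurable `f` by a continuous `b` is measurable. -/
theorem measurable_moll {b f : T3 → ℝ} (hb : Continuous b) (hf : Measurable f) :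
    Measurable fun x => ∫ y, b y * f (x - y) := by
  have hm : Measurable fun p : T3 × T3 => b p.2 * f (p.1 - p.2) :=
    (hb.measurable.comp measurable_snd).mul (hf.comp (measurable_fst.sub measurable_snd))
  exact (hm.stronglyMeasurable.integral_prod_right' (ν := (volume : Measure T3))).measurable

/-- A probability kernel does not increase sup norms: `|∫ b(y) f(x − y) dy| ≤ C` if `|f| ≤ C`,
`b ≥ 0`, `∫ b = 1`. -/
theorem abs_moll_le {b f : T3 → ℝ} (hb : Continuous b) (hb0 : ∀ y, 0 ≤ b y) (hb1 : ∫ y, b y = 1)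
    {C : ℝ} (hC : ∀ x, |f x| ≤ C) (x : T3) : |∫ y, b y * f (x - y)| ≤ C := by
  calc |∫ y, b y * f (x - y)| ≤ ∫ y, |b y * f (x - y)| := abs_integral_le_integral_abs
    _ ≤ ∫ y, b y * C :=
        integral_mono_of_nonneg (Eventually.of_forall fun _ => abs_nonneg _)
          ((hb.integrable_of_hasCompactSupport (.of_compactSpace b)).mul_const C) (Eventually.of_forall fun y => by
            show |b y * f (x - y)| ≤ b y * C
            rw [abs_mul, abs_of_nonneg (hb0 y)]
            exact mul_le_mul_of_nonneg_left (hC _) (hb0 y))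
    _ = C := by rw [integral_mul_const, hb1, one_mul]

/-- **Fubini and translation invariance**: `∫ₓ ∫_y b(y) f(x − y) dy dx = (∫ b) (∫ f)` for integrable
`b`, `f` on `𝕋³`. -/
theorem integral_integral_mul_comp_sub {b f : T3 → ℝ} (hb : Integrable b) (hf : Integrable f) :
    ∫ x, ∫ y, b y * f (x - y) = (∫ y, b y) * ∫ x, f x := by
  rw [integral_integral_swap (integrable_prod_mul_comp_sub hb hf)]
  have h1 : ∀ y, ∫ x, b y * f (x - y) = b y * ∫ x, f x := fun y => by
    rw [integral_const_mul, integral_sub_right_eq_self f y]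
  simp_rw [h1]
  exact integral_mul_const _ _

/-! ## Jensen for the probability kernel `b(y) dy` -/

/-- **Pointwise Jensen / Cauchy–Schwarz**: `(∫ b(y) f(x − y) dy)² ≤ ∫ b(y) f(x − y)² dy` for a
continuous probability kernel `b ≥ 0` and bounded measurable `f` (variance identity). -/
theorem sq_moll_le {b f : T3 → ℝ} (hb : Continuous b) (hb0 : ∀ y, 0 ≤ b y) (hb1 : ∫ y, b y = 1)
    (hf : Measurable f) {C : ℝ} (hC : ∀ x, |f x| ≤ C) (x : T3) :
    (∫ y, b y * f (x - y)) ^ 2 ≤ ∫ y, b y * f (x - y) ^ 2 := by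
  set m : ℝ := ∫ y, b y * f (x - y) with hm
  have hbi : Integrable b := hb.integrable_of_hasCompactSupport (.of_compactSpace b)
  have h1 : Integrable (fun y => b y * f (x - y)) := integrable_mul_comp_sub hb hf hC x
  have h2 : Integrable (fun y => b y * f (x - y) ^ 2) :=
    integrable_mul_comp_sub hb (hf.pow_const 2) (C := C ^ 2)
      (fun z => by rw [abs_pow]; exact pow_le_pow_left₀ (abs_nonneg _) (hC z) 2) x
  have h0 : 0 ≤ ∫ y, b y * (f (x - y) - m) ^ 2 :=
    integral_nonneg fun y => mul_nonneg (hb0 y) (sq_nonneg _)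
  have hexp : ∫ y, b y * (f (x - y) - m) ^ 2 = (∫ y, b y * f (x - y) ^ 2) - 2 * m * m + m ^ 2 * 1 := by
    have hpt : ∀ y, b y * (f (x - y) - m) ^ 2 =
        b y * f (x - y) ^ 2 - 2 * m * (b y * f (x - y)) + m ^ 2 * b y := fun y => by ring
    simp_rw [hpt]
    rw [integral_add (h2.sub' (h1.const_mul _)) (hbi.const_mul _), integral_sub h2 (h1.const_mul _),
      integral_const_mul, integral_const_mul, hb1, ← hm]
  nlinarith [h0, hexp]

/-- **Jensen, integrated**: `∫ₓ (∫ b(y) f(x − y) dy)² dx ≤ ∫ f²` (pointwise Jensen, then Fubini and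
translation invariance). -/
theorem integral_sq_moll_le {b f : T3 → ℝ} (hb : Continuous b) (hb0 : ∀ y, 0 ≤ b y)
    (hb1 : ∫ y, b y = 1) (hf : Measurable f) {C : ℝ} (hC : ∀ x, |f x| ≤ C) :
    ∫ x, (∫ y, b y * f (x - y)) ^ 2 ≤ ∫ x, f x ^ 2 := by
  have hbi : Integrable b := hb.integrable_of_hasCompactSupport (.of_compactSpace b)
  have hf2 : ∀ z, |f z ^ 2| ≤ C ^ 2 := fun z => by
    rw [abs_pow]; exact pow_le_pow_left₀ (abs_nonneg _) (hC z) 2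
  have hf2i : Integrable (fun z => f z ^ 2) := HardSphereLDA.integrable_T3_of_abs_le (hf.pow_const 2) hf2
  have hright : Integrable (fun x => ∫ y, b y * f (x - y) ^ 2) :=
    (integrable_prod_mul_comp_sub hbi hf2i).integral_prod_left
  calc ∫ x, (∫ y, b y * f (x - y)) ^ 2 ≤ ∫ x, ∫ y, b y * f (x - y) ^ 2 :=
        integral_mono_of_nonneg (Eventually.of_forall fun _ => sq_nonneg _) hright
          (Eventually.of_forall fun x => sq_moll_le hb hb0 hb1 hf hC x)
    _ = (∫ y, b y) * ∫ x, f x ^ 2 := integral_integral_mul_comp_sub hbi hf2i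
    _ = ∫ x, f x ^ 2 := by rw [hb1, one_mul]

end MollifierCommutator

open MollifierCommutator

/-! ## The linear commutator estimate -/

/-- **Linear mollifier commutator on `𝕋³`.** For a continuous even probability kernel `b ≥ 0`
vanishing outside the flat ball `{euclidDist · 0 < r}`, a continuous weight `g` that is `G`-Lipschitz in
the flat distance (`|g(x) − g(y)| ≤ G · euclidDist x y`, `0 ≤ G`) and an integrable `e`,
`|∫ g (b⋆e − e)| ≤ G r ∫ |e|`: mollification by an even kernel is symmetric (`∫ g (b⋆e) = ∫ (b⋆g) e`),
and `|(b⋆g − g)(x)| ≤ ∫ b(y) |g(x − y) − g(x)| dy ≤ G r`. -/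
theorem mollifierCommutator_linear {b g e : T3 → ℝ} {r G : ℝ} (hb : Continuous b)
    (hb0 : ∀ y, 0 ≤ b y) (hb1 : ∫ y, b y = 1) (hbe : ∀ y, b (-y) = b y)
    (hbs : ∀ y, r ≤ Torus.euclidDist y 0 → b y = 0) (hg : Continuous g) (hG : 0 ≤ G)
    (hgL : ∀ x y, |g x - g y| ≤ G * Torus.euclidDist x y) (he : Integrable e) :
    |∫ x, g x * ((∫ y, b y * e (x - y)) - e x)| ≤ G * r * ∫ x, |e x| := by
  haveI : (volume : Measure T3).IsNegInvariant :=
    Measure.IsAddHaarMeasure.isNegInvariant_of_regular _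
  -- the Lipschitz bound along translates: `euclidDist (x - y) x = euclidDist y 0`
  have hgL' : ∀ x y, |g (x - y) - g x| ≤ G * Torus.euclidDist y 0 := fun x y => by
    have h1 : Torus.euclidDist (x - y) x = Torus.euclidDist y 0 := by
      rw [Torus.euclidDist_comm y 0, Torus.euclidDist_eq, Torus.euclidDist_eq, sub_sub_cancel_left,
        zero_sub]
    exact (hgL (x - y) x).trans_eq (by rw [h1])
  obtain ⟨A, hA⟩ := Torus.exists_forall_norm_le_of_continuous hg
  have hbi : Integrable b := hb.integrable_of_hasCompactSupport (.of_compactSpace b)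
  have hgi : Integrable g := hg.integrable_of_hasCompactSupport (.of_compactSpace g)
  -- the mollified field `b ⋆ e` and the mollified weight `b ⋆ g`
  have hbei : Integrable (fun x => ∫ y, b y * e (x - y)) :=
    (integrable_prod_mul_comp_sub hbi he).integral_prod_left
  have hbgI : ∀ x, Integrable (fun y => b y * g (x - y)) := fun x =>
    integrable_mul_comp_sub hb hg.measurable (fun z => (Real.norm_eq_abs _).symm.trans_le (hA z)) x
  have hbgm : Measurable fun x => ∫ y, b y * g (x - y) := measurable_moll hb hg.measurable
  have hbgA : ∀ x, |∫ y, b y * g (x - y)| ≤ A := fun x =>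
    abs_moll_le hb hb0 hb1 (fun z => (Real.norm_eq_abs _).symm.trans_le (hA z)) x
  -- symmetry: `∫ g (b⋆e) = ∫ e (b⋆g)`
  have hsym : ∫ x, g x * (∫ y, b y * e (x - y)) = ∫ x, e x * (∫ y, b y * g (x - y)) := by
    have h := Torus.integral_mul_convolution_comm hgi he hb hbe
    rw [Torus.convolution_comm_real e b, Torus.convolution_comm_real g b] at h
    simp only [convolution_def, ContinuousLinearMap.lsmul_apply, smul_eq_mul] at h
    rw [h]
    exact integral_congr_ae (Eventually.of_forall fun x => mul_comm _ _)
  -- rewrite the commutator against `e`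
  have hI1 : Integrable (fun x => g x * (∫ y, b y * e (x - y))) :=
    hbei.bdd_mul hg.aestronglyMeasurable (Eventually.of_forall hA)
  have hI2 : Integrable (fun x => g x * e x) :=
    he.bdd_mul hg.aestronglyMeasurable (Eventually.of_forall hA)
  have hI3 : Integrable (fun x => e x * (∫ y, b y * g (x - y))) :=
    he.mul_bdd hbgm.aestronglyMeasurable
      (Eventually.of_forall fun x => (Real.norm_eq_abs _).trans_le (hbgA x))
  have hI4 : Integrable (fun x => e x * g x) :=
    he.mul_bdd hg.aestronglyMeasurable (Eventually.of_forall hA)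
  have hinner : ∀ x, ∫ y, b y * (g (x - y) - g x) = (∫ y, b y * g (x - y)) - g x := fun x => by
    simp_rw [mul_sub]
    rw [integral_sub (hbgI x) (hbi.mul_const _), integral_mul_const, hb1, one_mul]
  have hsplit : ∫ x, g x * ((∫ y, b y * e (x - y)) - e x) =
      ∫ x, e x * (∫ y, b y * (g (x - y) - g x)) := by
    simp_rw [hinner, mul_sub]
    rw [integral_sub hI1 hI2, integral_sub hI3 hI4, hsym]
    congr 1
    exact integral_congr_ae (Eventually.of_forall fun x => mul_comm _ _)
  -- pointwise bound on the commutator `b⋆g − g`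
  have hcomm : ∀ x, |∫ y, b y * (g (x - y) - g x)| ≤ G * r := fun x => by
    calc |∫ y, b y * (g (x - y) - g x)| ≤ ∫ y, |b y * (g (x - y) - g x)| :=
          abs_integral_le_integral_abs
      _ ≤ ∫ y, b y * (G * r) :=
          integral_mono_of_nonneg (Eventually.of_forall fun _ => abs_nonneg _) (hbi.mul_const _)
            (Eventually.of_forall fun y => by
              show |b y * (g (x - y) - g x)| ≤ b y * (G * r)
              rw [abs_mul, abs_of_nonneg (hb0 y)]
              by_cases hby : b y = 0
              · simp [hby]
              · have hlt : Torus.euclidDist y 0 < r := lt_of_not_ge fun hge => hby (hbs y hge)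
                exact mul_le_mul_of_nonneg_left
                  ((hgL' x y).trans (mul_le_mul_of_nonneg_left hlt.le hG)) (hb0 y))
      _ = G * r := by rw [integral_mul_const, hb1, one_mul]
  rw [hsplit]
  calc |∫ x, e x * (∫ y, b y * (g (x - y) - g x))|
        ≤ ∫ x, |e x * (∫ y, b y * (g (x - y) - g x))| := abs_integral_le_integral_abs
    _ ≤ ∫ x, |e x| * (G * r) :=
        integral_mono_of_nonneg (Eventually.of_forall fun _ => abs_nonneg _) (he.abs.mul_const _)
          (Eventually.of_forall fun x => by
            show |e x * (∫ y, b y * (g (x - y) - g x))| ≤ |e x| * (G * r)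
            rw [abs_mul]
            exact mul_le_mul_of_nonneg_left (hcomm x) (abs_nonneg _))
    _ = G * r * ∫ x, |e x| := by rw [integral_mul_const, mul_comm]

/-! ## The second-order estimate -/

/-- **Second-order mollifier-commutator estimate on `𝕋³`** (registered stub `mollifierCommutator_secondOrder`,
RoutePatchC11 §2, deterministic core of the claim that the two-scale statements [TS]/[TSχ] are absorbed by a
closed-loop relative-entropy dock).  Data: a continuous even probability kernel `b ≥ 0` on `𝕋³` vanishing
outside the flat ball `{euclidDist · 0 < r}`; a bounded measurable field `U` and a continuous comparison
field `U_c`, both bounded by `K`; `F, F′ = Fp` continuous with the Taylor inequality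
`|F a − F c − F′(c)(a − c)| ≤ M (a − c)²` on `[−K, K]`; a continuous weight `w`, `|w| ≤ W`, whose composite
`g = w · F′(U_c)` satisfies `|g| ≤ A` and `|g(x) − g(y)| ≤ G · euclidDist x y`.  Conclusion, with
`(b⋆f)(x) = ∫ b(y) f(x − y) dy` and `e = U − U_c`:
`|∫ w (F(b⋆U) − F(U))| ≤ G r ∫|e| + A ∫|b⋆U_c − U_c| + 3 W M ∫ e² + 2 W M ∫ (b⋆U_c − U_c)²` — second order
in `e` except for the linear term, which carries the factor `r`. -/
theorem mollifierCommutator_secondOrder : ∀ (b U Uc w : T3 → ℝ) (F Fp : ℝ → ℝ) (r K W A G M : ℝ), Continuous b → (∀ y, 0 ≤ b y) → (∫ y, b y = 1) → (∀ y, b (-y) = b y) → (∀ y, r ≤ Literature.Analysis.FluidPDE.Torus.euclidDist y 0 → b y = 0) → Measurable U → (∀ x, |U x| ≤ K) → Continuous Uc → (∀ x, |Uc x| ≤ K) → Continuous F → Continuous Fp → 0 ≤ M → (∀ a c, |a| ≤ K → |c| ≤ K → |F a - F c - Fp c * (a - c)| ≤ M * (a - c) ^ 2) → Continuous w → (∀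 x, |w x| ≤ W) → 0 ≤ G → (∀ x, |w x * Fp (Uc x)| ≤ A) → (∀ x y, |w x * Fp (Uc x) - w y * Fp (Uc y)| ≤ G * Literature.Analysis.FluidPDE.Torus.euclidDist x y) → |∫ x, w x * (F (∫ y, b y * U (x - y)) - F (U x))| ≤ G * r * (∫ x, |U x - Uc x|) + A * (∫ x, |(∫ y, b y * Uc (x - y)) - Uc x|) + 3 * W * M * (∫ x, (U x - Uc x) ^ 2) + 2 * W * M * (∫ x, ((∫ y, b y * Uc (x - y)) - Uc x) ^ 2) := by
  intro b U Uc w F Fp r K W A G M hb hb0 hb1 hbe hbs hUm hUK hUc hUcK hF hFp hM hT hw hwW hG hgA hgL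
  -- the fields: `e = U − U_c`, `g = w F′(U_c)`, `V = b⋆U`, `Vc = b⋆U_c`, `Ve = b⋆e`, and the Taylor remainders
  set e : T3 → ℝ := fun x => U x - Uc x with he_def
  set g : T3 → ℝ := fun x => w x * Fp (Uc x) with hg_def
  set V : T3 → ℝ := fun x => ∫ y, b y * U (x - y) with hV_def
  set Vc : T3 → ℝ := fun x => ∫ y, b y * Uc (x - y) with hVc_def
  set Ve : T3 → ℝ := fun x => ∫ y, b y * e (x - y) with hVe_def
  set R1 : T3 → ℝ := fun x => w x * (F (V x) - F (Uc x) - Fp (Uc x) * (V x - Uc x)) with hR1_def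
  set R2 : T3 → ℝ := fun x => w x * (F (U x) - F (Uc x) - Fp (Uc x) * (U x - Uc x)) with hR2_def
  show |∫ x, w x * (F (V x) - F (U x))| ≤ G * r * (∫ x, |e x|) + A * (∫ x, |Vc x - Uc x|)
    + 3 * W * M * (∫ x, (e x) ^ 2) + 2 * W * M * (∫ x, (Vc x - Uc x) ^ 2)
  -- constants, measurability, bounds
  have hK : 0 ≤ K := (abs_nonneg _).trans (hUK 0)
  have hW : 0 ≤ W := (abs_nonneg _).trans (hwW 0)
  have hUcm : Measurable Uc := hUc.measurable
  have hem : Measurable e := hUm.sub hUcm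
  have heK : ∀ x, |e x| ≤ 2 * K := fun x =>
    (abs_sub (U x) (Uc x)).trans (by linarith [hUK x, hUcK x])
  have hei : Integrable e := HardSphereLDA.integrable_T3_of_abs_le hem heK
  have hgc : Continuous g := hw.mul (hFp.comp hUc)
  have hgA' : ∀ x, ‖g x‖ ≤ A := fun x => (Real.norm_eq_abs _).trans_le (hgA x)
  have hVm : Measurable V := measurable_moll hb hUm
  have hVK : ∀ x, |V x| ≤ K := abs_moll_le hb hb0 hb1 hUK
  have hVcm : Measurable Vc := measurable_moll hb hUcm
  have hVcK : ∀ x, |Vc x| ≤ K := abs_moll_le hb hb0 hb1 hUcK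
  have hVem : Measurable Ve := measurable_moll hb hem
  have hVeK : ∀ x, |Ve x| ≤ 2 * K := abs_moll_le hb hb0 hb1 heK
  have hsq : ∀ {f : T3 → ℝ} {C : ℝ}, Measurable f → (∀ x, |f x| ≤ C) → Integrable (fun x => f x ^ 2) :=
    fun hf hC => HardSphereLDA.integrable_T3_of_abs_le (hf.pow_const 2)
      (fun x => by rw [abs_pow]; exact pow_le_pow_left₀ (abs_nonneg _) (hC x) 2)
  have hdV : ∀ x, |V x - Uc x| ≤ 2 * K := fun x =>
    (abs_sub (V x) (Uc x)).trans (by linarith [hVK x, hUcK x])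
  have hdVc : ∀ x, |Vc x - Uc x| ≤ 2 * K := fun x =>
    (abs_sub (Vc x) (Uc x)).trans (by linarith [hVcK x, hUcK x])
  have hdV2i : Integrable (fun x => (V x - Uc x) ^ 2) := hsq (hVm.sub hUcm) hdV
  have hdVci : Integrable (fun x => Vc x - Uc x) := HardSphereLDA.integrable_T3_of_abs_le (hVcm.sub hUcm) hdVc
  have hdVc2i : Integrable (fun x => (Vc x - Uc x) ^ 2) := hsq (hVcm.sub hUcm) hdVc
  have he2i : Integrable (fun x => e x ^ 2) := hsq hem heK
  have hVe2i : Integrable (fun x => Ve x ^ 2) := hsq hVem hVeK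
  -- linearity of the mollification: `b⋆U = b⋆e + b⋆U_c`
  have hIUc : ∀ x, Integrable (fun y => b y * Uc (x - y)) := integrable_mul_comp_sub hb hUcm hUcK
  have hVsplit : ∀ x, V x = Ve x + Vc x := fun x => by
    have hIe : Integrable (fun y => b y * (U (x - y) - Uc (x - y))) :=
      integrable_mul_comp_sub hb hem heK x
    show (∫ y, b y * U (x - y)) = (∫ y, b y * (U (x - y) - Uc (x - y))) + ∫ y, b y * Uc (x - y)
    rw [← integral_add hIe (hIUc x)]
    congr 1
    funext y
    ring
  -- pointwise Taylor expansion at `U_c(x)`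
  have hpt : ∀ x, w x * (F (V x) - F (U x)) =
      g x * (Ve x - e x) + g x * (Vc x - Uc x) + (R1 x - R2 x) := fun x => by
    show w x * (F (V x) - F (U x)) = w x * Fp (Uc x) * (Ve x - (U x - Uc x))
      + w x * Fp (Uc x) * (Vc x - Uc x) + (w x * (F (V x) - F (Uc x) - Fp (Uc x) * (V x - Uc x))
      - w x * (F (U x) - F (Uc x) - Fp (Uc x) * (U x - Uc x)))
    rw [hVsplit x]
    ring
  have hR1b : ∀ x, |R1 x| ≤ W * M * (V x - Uc x) ^ 2 := fun x => by
    show |w x * (F (V x) - F (Uc x) - Fp (Uc x) * (V x - Uc x))| ≤ W * M * (V x - Uc x) ^ 2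
    rw [abs_mul, mul_assoc]
    exact mul_le_mul (hwW x) (hT _ _ (hVK x) (hUcK x)) (abs_nonneg _) hW
  have hR2b : ∀ x, |R2 x| ≤ W * M * e x ^ 2 := fun x => by
    show |w x * (F (U x) - F (Uc x) - Fp (Uc x) * (U x - Uc x))| ≤ W * M * (U x - Uc x) ^ 2
    rw [abs_mul, mul_assoc]
    exact mul_le_mul (hwW x) (hT _ _ (hUK x) (hUcK x)) (abs_nonneg _) hW
  have hFm : Measurable F := hF.measurable
  have hFpm : Measurable Fp := hFp.measurable
  have hR1i : Integrable R1 := by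
    refine Integrable.mono' (hdV2i.const_mul (W * M)) ?_
      (Eventually.of_forall fun x => (Real.norm_eq_abs _).trans_le (hR1b x))
    exact (hw.measurable.mul (((hFm.comp hVm).sub (hFm.comp hUcm)).sub
      ((hFpm.comp hUcm).mul (hVm.sub hUcm)))).aestronglyMeasurable
  have hR2i : Integrable R2 := by
    refine Integrable.mono' (he2i.const_mul (W * M)) ?_
      (Eventually.of_forall fun x => (Real.norm_eq_abs _).trans_le (hR2b x))
    exact (hw.measurable.mul (((hFm.comp hUm).sub (hFm.comp hUcm)).sub
      ((hFpm.comp hUcm).mul (hUm.sub hUcm)))).aestronglyMeasurable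
  have hP1 : Integrable (fun x => g x * (Ve x - e x)) :=
    ((HardSphereLDA.integrable_T3_of_abs_le hVem hVeK).sub' hei).bdd_mul hgc.aestronglyMeasurable
      (Eventually.of_forall hgA')
  have hP2 : Integrable (fun x => g x * (Vc x - Uc x)) :=
    hdVci.bdd_mul hgc.aestronglyMeasurable (Eventually.of_forall hgA')
  -- integrate the expansion
  have hI : ∫ x, w x * (F (V x) - F (U x)) =
      (∫ x, g x * (Ve x - e x)) + (∫ x, g x * (Vc x - Uc x)) + ((∫ x, R1 x) - ∫ x, R2 x) := by
    rw [← integral_sub hR1i hR2i, ← integral_add hP1 hP2,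
      ← integral_add (hP1.fun_add hP2) (hR1i.sub' hR2i)]
    exact integral_congr_ae (Eventually.of_forall hpt)
  -- the four bounds
  have hB1 : |∫ x, g x * (Ve x - e x)| ≤ G * r * ∫ x, |e x| :=
    mollifierCommutator_linear hb hb0 hb1 hbe hbs hgc hG hgL hei
  have hB2 : |∫ x, g x * (Vc x - Uc x)| ≤ A * ∫ x, |Vc x - Uc x| := by
    calc |∫ x, g x * (Vc x - Uc x)| ≤ ∫ x, |g x * (Vc x - Uc x)| := abs_integral_le_integral_abs
      _ ≤ ∫ x, A * |Vc x - Uc x| :=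
          integral_mono_of_nonneg (Eventually.of_forall fun _ => abs_nonneg _)
            (hdVci.abs.const_mul A) (Eventually.of_forall fun x => by
              show |g x * (Vc x - Uc x)| ≤ A * |Vc x - Uc x|
              rw [abs_mul]
              exact mul_le_mul_of_nonneg_right (hgA x) (abs_nonneg _))
      _ = A * ∫ x, |Vc x - Uc x| := integral_const_mul _ _
  have hB3 : |∫ x, R1 x| ≤ W * M * ∫ x, (V x - Uc x) ^ 2 := by
    calc |∫ x, R1 x| ≤ ∫ x, |R1 x| := abs_integral_le_integral_abs
      _ ≤ ∫ x, W * M * (V x - Uc x) ^ 2 :=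
          integral_mono_of_nonneg (Eventually.of_forall fun _ => abs_nonneg _)
            (hdV2i.const_mul _) (Eventually.of_forall hR1b)
      _ = W * M * ∫ x, (V x - Uc x) ^ 2 := integral_const_mul _ _
  have hB4 : |∫ x, R2 x| ≤ W * M * ∫ x, e x ^ 2 := by
    calc |∫ x, R2 x| ≤ ∫ x, |R2 x| := abs_integral_le_integral_abs
      _ ≤ ∫ x, W * M * e x ^ 2 :=
          integral_mono_of_nonneg (Eventually.of_forall fun _ => abs_nonneg _)
            (he2i.const_mul _) (Eventually.of_forall hR2b)
      _ = W * M * ∫ x, e x ^ 2 := integral_const_mul _ _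
  have hB5 : ∫ x, (V x - Uc x) ^ 2 ≤ 2 * (∫ x, Ve x ^ 2) + 2 * ∫ x, (Vc x - Uc x) ^ 2 := by
    calc ∫ x, (V x - Uc x) ^ 2 ≤ ∫ x, (2 * Ve x ^ 2 + 2 * (Vc x - Uc x) ^ 2) :=
          integral_mono hdV2i ((hVe2i.const_mul 2).fun_add (hdVc2i.const_mul 2)) fun x => by
            show (V x - Uc x) ^ 2 ≤ 2 * Ve x ^ 2 + 2 * (Vc x - Uc x) ^ 2
            rw [hVsplit x]
            nlinarith [sq_nonneg (Ve x - (Vc x - Uc x))]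
      _ = 2 * (∫ x, Ve x ^ 2) + 2 * ∫ x, (Vc x - Uc x) ^ 2 := by
          rw [integral_add (hVe2i.const_mul 2) (hdVc2i.const_mul 2), integral_const_mul,
            integral_const_mul]
  have hB6 : ∫ x, Ve x ^ 2 ≤ ∫ x, e x ^ 2 := integral_sq_moll_le hb hb0 hb1 hem heK
  -- assemble
  have hWM : 0 ≤ W * M := mul_nonneg hW hM
  have hB3' : |∫ x, R1 x| ≤ W * M * (2 * (∫ x, e x ^ 2) + 2 * ∫ x, (Vc x - Uc x) ^ 2) :=
    hB3.trans (mul_le_mul_of_nonneg_left (hB5.trans (by linarith)) hWM)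
  have habs : |(∫ x, g x * (Ve x - e x)) + (∫ x, g x * (Vc x - Uc x)) + ((∫ x, R1 x) - ∫ x, R2 x)|
      ≤ |∫ x, g x * (Ve x - e x)| + |∫ x, g x * (Vc x - Uc x)| + (|∫ x, R1 x| + |∫ x, R2 x|) :=
    (abs_add_le _ _).trans (add_le_add (abs_add_le _ _) (abs_sub _ _))
  rw [hI]
  linarith [habs, hB1, hB2, hB3', hB4]

end

end Summit.AtomisticToContinuum.HydrodynamicLimit.Theorems.HemisphereAffineSlaving
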